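import Mathlib
import HarnessLib
import Literature.Geometry.DiscreteGeometry.KissingPatterns
import Summits.AtomisticToContinuum.Crystallization.Theses.GappedShellCensus

/-!
# Sketch — crux-ideate round 1, ideator 1, crux `GappedShellCensus.FiveFoldRationing`
(item stmt-AtomisticToContinuum-15931).

First lemmas of the idea cards `Ideas/convex-chamber-rod-rigidity.md` (Card 1) and
`Ideas/ring-closure-census.md` (Card 2).  Nothing here is proved; every `theorem` is a SIGNATURE
that must elaborate (proof `sorry`).  All constants are the crux's: tolerance `1/50`, gap `63/50`,
closeness `1/5`, scale `a > 0`.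
-/

noncomputable section

open scoped BigOperators
open Filter Set Function

namespace Summit.AtomisticToContinuum.Crystallization.Cruxes.FiveFoldRationing.Sketch

open Literature.Geometry.DiscreteGeometry
open Summit.AtomisticToContinuum.Crystallization.Theses.GappedShellCensus

local notation "E³" => EuclideanSpace ℝ (Fin 3)

/-! ### The crux hypothesis, split into its radial part and its typing part -/

/-- `w` is a BOND partner of `y` at scale `a`: `w ≠ y` and `dist y w ≤ a(1 + 1/50)`. -/
def Bonded (a : ℝ) (y w : E³) : Prop := w ≠ y ∧ dist y w ≤ a * (1 + 1 / 50)

/-- the bond shell of `y` in `Y`. -/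
def shell (a : ℝ) (Y : Set E³) (y : E³) : Set E³ := {w ∈ Y | Bonded a y w}

/-- common bond partners of `y` and `w`. -/
def commonNbrs (a : ℝ) (Y : Set E³) (y w : E³) : Set E³ :=
  {u ∈ Y | u ≠ y ∧ u ≠ w ∧ dist y u ≤ a * (1 + 1 / 50) ∧ dist w u ≤ a * (1 + 1 / 50)}

/-- GAPPED-TWELVE (the radial part of the crux hypothesis): exactly twelve bond partners, hard
core `a(1 − 1/50)`, nobody in the open annulus `(a(1+1/50), 63a/50)`. -/
def GappedTwelve (a : ℝ) (Y : Set E³) : Prop :=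
  ∀ y ∈ Y, (shell a Y y).ncard = 12 ∧
    ∀ w ∈ Y, w ≠ y → a * (1 - 1 / 50) ≤ dist y w ∧
      (dist y w ≤ a * (1 + 1 / 50) ∨ a * (63 / 50) ≤ dist y w)

/-- the decahedral-axis pattern (bicapped pentagonal prism), verbatim from the route file. -/
def decPattern : Finset E³ :=
  (Finset.univ.image fun k : Fin 5 =>
      !₂[Real.sqrt 3 / 2 * Real.cos (2 * Real.pi * k / 5),
        Real.sqrt 3 / 2 * Real.sin (2 * Real.pi * k / 5), (1 : ℝ) / 2]) ∪
    (Finset.univ.image fun k : Fin 5 =>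
      !₂[Real.sqrt 3 / 2 * Real.cos (2 * Real.pi * k / 5),
        Real.sqrt 3 / 2 * Real.sin (2 * Real.pi * k / 5), -(1 : ℝ) / 2]) ∪
    {!₂[(0 : ℝ), 0, 1], !₂[(0 : ℝ), 0, -1]}

/-- the rescaled, recentred shell of `y` is `1/5`-close to fcc or hcp. -/
def CleanAt (a : ℝ) (Y : Set E³) (y : E³) : Prop :=
  ∃ T : Finset E³, (↑T : Set E³) = (fun w => a⁻¹ • (w - y)) '' shell a Y y ∧
    (ShellCloseTo (1 / 5) T fccKissingPattern ∨ ShellCloseTo (1 / 5) T hcpKissingPattern)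

/-- … or to the decahedral-axis pattern (the typing part of the crux hypothesis). -/
def TypedAt (a : ℝ) (Y : Set E³) (y : E³) : Prop :=
  ∃ T : Finset E³, (↑T : Set E³) = (fun w => a⁻¹ • (w - y)) '' shell a Y y ∧
    (ShellCloseTo (1 / 5) T fccKissingPattern ∨ ShellCloseTo (1 / 5) T hcpKissingPattern ∨
      ShellCloseTo (1 / 5) T decPattern)

/-! ### Card 2 — ring closure (the local lemma `L1`, part (i)+(ii)) -/

/-- RING CLOSURE at `(1/50, 63/50, 1/5)`: in an all-gapped-twelve, all-typed `Y`, the common bond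
partners `C` of every bond form, under the bond relation, either a graph with exactly two edges on
four vertices (ring words `TOTO`, `TTOO`) or a five-cycle (word `T⁵`).  Excludes the refuter's
OPENED five-ring (a five-PATH) and every three-ring. -/
def RingClosure : Prop :=
  ∀ (Y : Set E³) (a : ℝ), 0 < a → GappedTwelve a Y → (∀ y ∈ Y, TypedAt a Y y) →
    ∀ y ∈ Y, ∀ w ∈ Y, Bonded a y w →
      ((commonNbrs a Y y w).ncard = 4 ∧
          {p : E³ × E³ | p.1 ∈ commonNbrs a Y y w ∧ p.2 ∈ commonNbrs a Y y w ∧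
              Bonded a p.1 p.2}.ncard = 4) ∨
        ((commonNbrs a Y y w).ncard = 5 ∧
          ∀ c ∈ commonNbrs a Y y w, {d ∈ commonNbrs a Y y w | Bonded a c d}.ncard = 2)

/-- OCTAHEDRAL COMPLETION (part (ii) of `L1`): whenever two common bond partners `c, d` of a bond
`(y, w)` are NOT bonded to each other and no third common partner is bonded to both, the six points
`y, w, c, d` plus two further sites of `Y` induce the octahedral graph: twelve bonds, three far
diagonals `(y,o), (w,o'), (c,d)`. -/
def OctahedralCompletion : Prop :=
  ∀ (Y : Set E³) (a : ℝ), 0 < a → GappedTwelve a Y → (∀ y ∈ Y, TypedAt a Y y) →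
    ∀ y ∈ Y, ∀ w ∈ Y, Bonded a y w → ∀ c ∈ commonNbrs a Y y w, ∀ d ∈ commonNbrs a Y y w,
      c ≠ d → ¬ Bonded a c d →
      (∀ e ∈ commonNbrs a Y y w, ¬ (Bonded a e c ∧ Bonded a e d)) →
        ∃ o ∈ Y, ∃ o' ∈ Y, Bonded a o o' ∧ Bonded a o w ∧ Bonded a o c ∧ Bonded a o d ∧
          Bonded a o' y ∧ Bonded a o' c ∧ Bonded a o' d ∧
          a * (63 / 50) ≤ dist y o ∧ a * (63 / 50) ≤ dist w o' ∧ a * (63 / 50) ≤ dist c d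

/-! ### Card 1 — rod rigidity of the octet complex -/

/-- `y` carries a FIVE-BOND: some bond of `y` has five common partners. -/
def fiveBondSites (a : ℝ) (Y : Set E³) : Set E³ :=
  {y ∈ Y | ∃ w ∈ Y, Bonded a y w ∧ (commonNbrs a Y y w).ncard = 5}

/-- the five-bond relation. -/
def FiveBond (a : ℝ) (Y : Set E³) (y w : E³) : Prop :=
  y ∈ Y ∧ w ∈ Y ∧ Bonded a y w ∧ (commonNbrs a Y y w).ncard = 5

/-- ROD RIGIDITY (Card 1's target, conditional on the local lemma `L1` = ring closure + octahedral
completion): the five-bonds of an all-gapped-twelve typed configuration form AT MOST ONE connected,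
endless, unbranched path (every site has `0` or `2` five-bonds; any two five-bond sites are joined by
a chain of five-bonds), and that path is not `R`-dense for any `R` (clean sites arbitrarily far from
it exist).  Ideal-metric content: the T/O complex is the flat Barlow-type complex or the five-wedge
decahedral rod `C_{5θ_T} × ℝ`. -/
def RodRigidity : Prop :=
  ∀ (Y : Set E³) (a : ℝ), 0 < a → Y.Nonempty → GappedTwelve a Y → (∀ y ∈ Y, TypedAt a Y y) →
    (∀ y ∈ Y, {w ∈ Y | FiveBond a Y y w} = ∅ ∨ {w ∈ Y | FiveBond a Y y w}.ncard = 2) ∧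
    (∀ y ∈ fiveBondSites a Y, ∀ y' ∈ fiveBondSites a Y,
        Relation.ReflTransGen (FiveBond a Y) y y') ∧
    ∀ R : ℝ, ∃ c ∈ Y, ∀ y ∈ fiveBondSites a Y, R < dist y c

/-- Card 1, step A (signature): the local lemma implies rod rigidity — convex development of the
sheet chambers (Cartan–Hadamard for flat manifolds with locally convex polyhedral boundary), the
lineality of convex sets containing a line, the planar corner count `π/θ_O < 2`, `2π/θ_O ∉ ℕ`,
the link tiling (lunes/triangles ⇒ `n₅ ∈ {0, 2, 12}`), the icosahedral exclusion `20·Ω_max < 4π`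
at `2 %`, and simple connectivity of `ℝ³`. -/
theorem rodRigidity_of_local : RingClosure → OctahedralCompletion → RodRigidity := by
  sorry

/-- Card 1, step B (signature): off the five-bond path every site is fcc/hcp-CLEAN at `1/5`
(vertex stars of a `2 %` octet complex with `n₅ = 0` are `O(τ)`-close to their ideal
cuboctahedral/anticuboctahedral link). -/
theorem clean_off_axis : RingClosure → OctahedralCompletion →
    ∀ (Y : Set E³) (a : ℝ), 0 < a → GappedTwelve a Y → (∀ y ∈ Y, TypedAt a Y y) →
      ∀ y ∈ Y, y ∉ fiveBondSites a Y → CleanAt a Y y := by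
  sorry

/-- Card 1, composition (signature): rod rigidity + clean-off-axis give the crux BY NAME. -/
theorem fiveFoldRationing_of_rod :
    RodRigidity →
    (∀ (Y : Set E³) (a : ℝ), 0 < a → GappedTwelve a Y → (∀ y ∈ Y, TypedAt a Y y) →
      ∀ y ∈ Y, y ∉ fiveBondSites a Y → CleanAt a Y y) →
    FiveFoldRationing := by
  sorry

/-- Card 2, composition (signature): the census lemma feeds Card 1. -/
theorem fiveFoldRationing_of_local : RingClosure → OctahedralCompletion → FiveFoldRationing := by
  sorry

end Summit.AtomisticToContinuum.Crystallization.Cruxes.FiveFoldRationing.Sketch
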